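import Summits.CriticalPhenomena.PercolationContinuityZ3.Theses.PercPortalLadder
import Summits.CriticalPhenomena.PercolationContinuityZ3.Theorems.PercNearOneGluingNoHeavyLowerTailCSHTheoremOne
import Literature.Probability.Percolation.CoveringMonotonicity
import Literature.Probability.Percolation.ConnectivityProofs
import HarnessLib

/-!
# `PercPortalLadder.PlaneOfPortalGrid` (stmt-CriticalPhenomena-14518) — SETTLED after continuity

Item `stmt-CriticalPhenomena-14518` of route `CriticalPhenomena/PercPortalLadder` (support (glue)): `PortalGridRung → GridWallPersistence → PortalLadder`.

With `θ(p_c(ℤ³)) = 0` (p205010), `θ` of every edge-deleted subgraph of `ℤ³` vanishes at `p_c` at every vertex: deleting edges can only lower `θ` (Lyons–Peres Thm 6.47 covering inequality `LyonsPeres647.theta_le_of_surjOn_neighborSet` with the identity map) and `θ_{ℤ³}(v, p_c) = θ_{ℤ³}(0, p_c) = 0`.  The conclusion `PortalLadder` is proved outright; the hypotheses are not used.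

builds on p205010 (kernel theorem, internal audit signed; external expert review pending) — USED (`CSH.percolationContinuityZ3_holds`).  RSW3 lane, lead gen 28 (prover-prim-rsw3-lead-g28-0):
'after continuity — the ledger harvest'.
References: G. Kozma, N. Nitzan (2024), Thm. 6 / Conj. 3 [KozmaNitzan2024]; G. Grimmett, *Percolation* (1999), §8 [GrimmettPercolation1999].
-/

noncomputable section

namespace Summit.CriticalPhenomena.PercolationContinuityZ3.Theorems

namespace PercPortalLadderPlaneOfPortalGrid

open MeasureTheory Literature.Probability.Percolation Literature.Probability.LatticeModels

/-- **`PercPortalLadder.PlaneOfPortalGrid` (stmt-CriticalPhenomena-14518), settled.**  conclusion proved outright: `θ_{ℤ³∖W_P}(v,p_c) ≤ θ_{ℤ³}(0,p_c) = 0`.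
[cite: KozmaNitzan2024, Thm. 6 with Conj. 3 (p. 15)] -/
theorem planeOfPortalGrid_proof : Summit.CriticalPhenomena.PercolationContinuityZ3.Theses.PercPortalLadder.PlaneOfPortalGrid := by
  unfold Summit.CriticalPhenomena.PercolationContinuityZ3.Theses.PercPortalLadder.PlaneOfPortalGrid Summit.CriticalPhenomena.PercolationContinuityZ3.Theses.PercPortalLadder.PortalLadder
  intro _ _ P v
  have h0 : theta (zdGraph 3) (0 : Site 3) (criticalProbI 3) = 0 := CSH.percolationContinuityZ3_holds
  have key : ∀ E : Set (Sym2 (Site 3)),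
      theta ((zdGraph 3).deleteEdges E) v (criticalProbI 3) ≤ theta (zdGraph 3) v (criticalProbI 3) := fun E => by
    refine LyonsPeres647.theta_le_of_surjOn_neighborSet (zdGraph 3) _ id (fun x => ?_) v (criticalProbI 3)
    intro y hy
    refine ⟨y, ?_, rfl⟩
    rw [SimpleGraph.mem_neighborSet, SimpleGraph.deleteEdges_adj] at hy
    rw [SimpleGraph.mem_neighborSet]
    exact hy.1
  rw [theta_zdGraph_eq_theta_zero, h0] at key
  exact le_antisymm (key _) (by unfold theta; exact measureReal_nonneg)

end PercPortalLadderPlaneOfPortalGrid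

end Summit.CriticalPhenomena.PercolationContinuityZ3.Theorems

end
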